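import Literature.Probability.LatticeModels.IsingLimitLaw
import HarnessLib

/-!
# Magnetization laws as finite sums; Gaussian tilts = rank-one coupling shifts

Trunk T-STATMECH (`Literature/Probability/LatticeModels`), companion of `IsingLimitLaw.lean`
(route RiemannHypothesis/LeeYang: the barrier "a witness with uniform ferromagnetic margin
`Jᵢⱼ ≥ c wᵢwⱼ` would put `e^{-cu²}Φ du` in the class of Ising limit laws").

* `integral_isingMagnetizationLaw_eq_sum` — `∫ f d(law J w) = Σ_s (B_s/Z) • f(M_s)`: the law is the
  finite mixture of Dirac masses at the attainable magnetizations `M_s = Σ wᵢ sᵢ` with the Gibbs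
  weights `B_s / Z`.
* `isingBoltzmann_add_rankOne` — shifting the couplings by the rank-one matrix `c wᵢ wⱼ` multiplies
  the Boltzmann weight by `e^{c M_s²}` (`Σᵢⱼ c wᵢwⱼ sᵢsⱼ = c (Σᵢ wᵢsᵢ)²`).
* `integral_isingMagnetizationLaw_add_rankOne` — hence the magnetization law of `J + c w ⊗ w` is the
  Gaussian tilt of that of `J`: `∫ f d(law (J + c w⊗w) w) = (∫ e^{cu²} f d(law J w)) / ∫ e^{cu²} d(law J w)`
  (real- and complex-valued versions).
* `isingMagnetizationLaw_add_diagonal` — diagonal couplings are immaterial (`sᵢ² = 1`).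

## References

* C. M. Newman, CPAM 27 (1974) 143–159, §1; Proc. AMS 61 (1976), §1 (Gaussian tilts `e^{bt²}`).
* B. Simon, R. B. Griffiths, CMP 33 (1973) 145–164, §II (Curie–Weiss couplings as `M²` terms).
-/

noncomputable section

open MeasureTheory Filter Topology Complex

namespace Literature.Probability.LatticeModels

variable {n : ℕ}

/-! ### The law as a finite sum -/

/-- **The magnetization law is a finite Gibbs mixture of Dirac masses**:
`∫ f d(law J w) = Σ_s (B_s / Z) • f(M_s)`. [Newman 1974, §1] [folklore] -/
theorem integral_isingMagnetizationLaw_eq_sum (J : Fin n → Fin n → ℝ) (w : Fin n → ℝ)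
    {E : Type*} [NormedAddCommGroup E] [NormedSpace ℝ E] [CompleteSpace E] {f : ℝ → E}
    (hf : StronglyMeasurable f) :
    ∫ u, f u ∂(isingMagnetizationLaw n J w : Measure ℝ) =
      ∑ s : Fin n → Bool, (isingBoltzmann J s / isingPairPartition J) • f (weightedMagnetization w s) := by
  change ∫ u, f u ∂((isingPairPMF J).map (weightedMagnetization w)).toMeasure = _
  rw [← PMF.toMeasure_map (weightedMagnetization w) (isingPairPMF J) (measurable_of_config _),
    integral_map (measurable_of_config _).aemeasurable hf.aestronglyMeasurable, PMF.integral_eq_sum]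
  refine Finset.sum_congr rfl fun s _ => ?_
  rw [isingPairPMF, PMF.ofFintype_apply, ENNReal.toReal_ofReal
    (div_nonneg (isingBoltzmann_pos J s).le (isingPairPartition_pos J).le)]

/-! ### Rank-one coupling shifts are Gaussian tilts -/

/-- `Σᵢⱼ c wᵢ wⱼ sᵢ sⱼ = c M_s²`: shifting the couplings by `c wᵢwⱼ` adds `c M_s²` to the energy.
[Simon–Griffiths 1973, §II] [folklore] -/
theorem isingPairEnergy_add_rankOne (J : Fin n → Fin n → ℝ) (w : Fin n → ℝ) (c : ℝ)
    (s : Fin n → Bool) :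
    isingPairEnergy (fun i j => J i j + c * (w i * w j)) s =
      isingPairEnergy J s + c * weightedMagnetization w s ^ 2 := by
  simp only [isingPairEnergy, weightedMagnetization]
  rw [sq, Finset.sum_mul_sum, Finset.mul_sum, ← Finset.sum_add_distrib]
  refine Finset.sum_congr rfl fun i _ => ?_
  rw [Finset.mul_sum, ← Finset.sum_add_distrib]
  refine Finset.sum_congr rfl fun j _ => ?_
  ring

/-- The Boltzmann weight of `J + c w⊗w` is `B_s · e^{c M_s²}`. [folklore] -/
theorem isingBoltzmann_add_rankOne (J : Fin n → Fin n → ℝ) (w : Fin n → ℝ) (c : ℝ)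
    (s : Fin n → Bool) :
    isingBoltzmann (fun i j => J i j + c * (w i * w j)) s =
      isingBoltzmann J s * Real.exp (c * weightedMagnetization w s ^ 2) := by
  rw [isingBoltzmann, isingBoltzmann, isingPairEnergy_add_rankOne, Real.exp_add]

/-- The partition function of `J + c w⊗w` is `Z · ∫ e^{cu²} d(law J w)`. [folklore] -/
theorem isingPairPartition_add_rankOne (J : Fin n → Fin n → ℝ) (w : Fin n → ℝ) (c : ℝ) :
    isingPairPartition (fun i j => J i j + c * (w i * w j)) =
      isingPairPartition J *
        ∫ u, Real.exp (c * u ^ 2) ∂(isingMagnetizationLaw n J w : Measure ℝ) := by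
  rw [integral_isingMagnetizationLaw_eq_sum J w
    (by fun_prop : Continuous fun u : ℝ => Real.exp (c * u ^ 2)).stronglyMeasurable,
    Finset.mul_sum, isingPairPartition]
  refine Finset.sum_congr rfl fun s _ => ?_
  rw [isingBoltzmann_add_rankOne, smul_eq_mul]
  field_simp [(isingPairPartition_pos J).ne']

/-- **Rank-one coupling shift = Gaussian tilt** (vector-valued test functions):
`∫ f d(law (J + c w⊗w) w) = (∫ e^{cu²} d(law J w))⁻¹ • ∫ e^{cu²} • f d(law J w)`.
[Newman 1976, §1; Simon–Griffiths 1973, §II] [folklore] -/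
theorem integral_isingMagnetizationLaw_add_rankOne (J : Fin n → Fin n → ℝ) (w : Fin n → ℝ)
    (c : ℝ) {E : Type*} [NormedAddCommGroup E] [NormedSpace ℝ E] [CompleteSpace E] {f : ℝ → E}
    (hf : StronglyMeasurable f) :
    ∫ u, f u ∂(isingMagnetizationLaw n (fun i j => J i j + c * (w i * w j)) w : Measure ℝ) =
      (∫ u, Real.exp (c * u ^ 2) ∂(isingMagnetizationLaw n J w : Measure ℝ))⁻¹ •
        ∫ u, Real.exp (c * u ^ 2) • f u ∂(isingMagnetizationLaw n J w : Measure ℝ) := by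
  have hZ := isingPairPartition_pos J
  have hI : 0 < ∫ u, Real.exp (c * u ^ 2) ∂(isingMagnetizationLaw n J w : Measure ℝ) := by
    have h := isingPairPartition_pos (fun i j => J i j + c * (w i * w j))
    rw [isingPairPartition_add_rankOne] at h
    exact pos_of_mul_pos_right h hZ.le
  have hg : StronglyMeasurable fun u : ℝ => Real.exp (c * u ^ 2) • f u :=
    (by fun_prop : Continuous fun u : ℝ => Real.exp (c * u ^ 2)).stronglyMeasurable.smul hf
  rw [integral_isingMagnetizationLaw_eq_sum _ w hf, integral_isingMagnetizationLaw_eq_sum J w hg,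
    isingPairPartition_add_rankOne, Finset.smul_sum]
  refine Finset.sum_congr rfl fun s _ => ?_
  rw [isingBoltzmann_add_rankOne, smul_smul, smul_smul]
  congr 1
  field_simp

/-- The same for the total mass of a tilt: `∫ e^{bu²} d(law (J + c w⊗w) w) =
(∫ e^{(b+c)u²} d(law J w)) / ∫ e^{cu²} d(law J w)`. [folklore] -/
theorem integral_exp_mul_sq_isingMagnetizationLaw_add_rankOne (J : Fin n → Fin n → ℝ)
    (w : Fin n → ℝ) (c b : ℝ) :
    ∫ u, Real.exp (b * u ^ 2) ∂(isingMagnetizationLaw n (fun i j => J i j + c * (w i * w j)) w :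
        Measure ℝ) =
      (∫ u, Real.exp ((b + c) * u ^ 2) ∂(isingMagnetizationLaw n J w : Measure ℝ)) /
        ∫ u, Real.exp (c * u ^ 2) ∂(isingMagnetizationLaw n J w : Measure ℝ) := by
  rw [integral_isingMagnetizationLaw_add_rankOne J w c
    (by fun_prop : Continuous fun u : ℝ => Real.exp (b * u ^ 2)).stronglyMeasurable,
    smul_eq_mul, div_eq_inv_mul]
  congr 1
  refine integral_congr_ae (Eventually.of_forall fun u => ?_)
  simp only [smul_eq_mul, ← Real.exp_add]
  ring_nf

/-! ### Diagonal couplings are immaterial -/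

/-- Adding a diagonal matrix to the couplings multiplies every Boltzmann weight by the same
constant `e^{Σ dᵢ}` (`sᵢ² = 1`). [folklore] -/
theorem isingBoltzmann_add_diagonal (J : Fin n → Fin n → ℝ) (d : Fin n → ℝ) (s : Fin n → Bool) :
    isingBoltzmann (fun i j => J i j + if i = j then d i else 0) s =
      isingBoltzmann J s * Real.exp (∑ i, d i) := by
  rw [isingBoltzmann, isingBoltzmann, ← Real.exp_add]
  congr 1
  simp only [isingPairEnergy, add_mul, Finset.sum_add_distrib, ite_mul, zero_mul,
    Finset.sum_ite_eq, Finset.mem_univ, if_true]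
  congr 1
  refine Finset.sum_congr rfl fun i _ => ?_
  unfold spinVal; cases s i <;> simp

/-- Hence the Gibbs probability, and with it the magnetization law, does not depend on the diagonal
couplings. [folklore] -/
theorem isingPairPMF_add_diagonal (J : Fin n → Fin n → ℝ) (d : Fin n → ℝ) :
    isingPairPMF (fun i j => J i j + if i = j then d i else 0) = isingPairPMF J := by
  refine PMF.ext fun s => ?_
  simp only [isingPairPMF, PMF.ofFintype_apply]
  congr 1
  rw [isingPairPartition, isingPairPartition]
  simp only [isingBoltzmann_add_diagonal, ← Finset.sum_mul]
  field_simp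

/-- **Diagonal couplings are immaterial** for the magnetization law. [folklore] -/
theorem isingMagnetizationLaw_add_diagonal (J : Fin n → Fin n → ℝ) (d : Fin n → ℝ) (w : Fin n → ℝ) :
    isingMagnetizationLaw n (fun i j => J i j + if i = j then d i else 0) w =
      isingMagnetizationLaw n J w := by
  apply ProbabilityMeasure.toMeasure_injective
  change ((isingPairPMF _).map (weightedMagnetization w)).toMeasure =
    ((isingPairPMF J).map (weightedMagnetization w)).toMeasure
  rw [isingPairPMF_add_diagonal]

end Literature.Probability.LatticeModels
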